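import Mathlib
import HarnessLib
import Summits.ResolutionOfSingularities.ResolutionOfSingularities.Theorems.WildQuotientsWildQuotientResolutionJordanThreeTwoFrame

/-!
# N4a frame, part 2: the charts `V[x_a]` and `V[x_d²]` of `Bl_I 𝔸ⁿ` are `G`-stable
(crux stmt-ResolutionOfSingularities-15640 `WildQuotients.WildQuotientResolution`, line `Sketch`;
chain w45c post-V5 width target N4a `JordanThreeTwo.jordanThreeTwo_hasResolution`
(res-L1-w45c-plan-1 NO OBJECTION 2026-08-27T14:24:34Z / 15:17:58Z), part (F0′) of
res-L1-w45c-stub-2's file plan; companion of `…JordanThreeTwoFrame` (p544068). [OURS · L1 W4.5c] —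
NOT a statement of any manuscript; replaces the role of no printed item. Def-free.)

For the `J₃ ⊕ J₂` datum and `I = (x_a, x_b², x_bx_d, x_d²)` (spelling of record
`Ideal.span (Set.range ![X a, X b ^ 2, X b * X d, X d ^ 2])`), the principal charts `V[x_a]` (the
cone piece) and `V[x_d²]` (the second Király–Lütkebohmert piece) of `V = Bl_I 𝔸ⁿ` are stable under
the lifted action `IsBlowup.liftAction ρ hJ` (`hJ` ABSTRACT, as in res-L1-w45c-stub-3's K1/K2
p544113), because their generators are invariant: `g • x_a = x_a`, `g • x_d² = x_d²`
(`JordanThreeTwo.smul_X_a_eq` / `smul_X_d_sq_eq`, p544068) — `ToricExit.preimage_blowupChart_eq_self_of_action`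
(p488231) with `ToricExit.specAction_appTop_ΓSpecIso_inv`.

ENGINEERING NOTE (res-L1-w45c-stub-2 g5, 2026-08-27T16:1xZ): in p544068 these two statements were
written over a `variable (hJ : …)` binder whose type used a file-local `notation3`; on the farm such
theorems elaborate WITHOUT error but are NOT added to the environment (rc 0, declaration absent —
verified by `#check`). Here `hJ` is an explicit binder of each theorem and the declarations exist.
-/

-- single-problem summit: the doubled namespace component `ResolutionOfSingularities` is forced
set_option linter.dupNamespace false

noncomputable section

open CategoryTheory AlgebraicGeometry TopologicalSpace MvPolynomial
open Literature.AlgebraicGeometry.Resolution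

namespace Summit.ResolutionOfSingularities.ResolutionOfSingularities.Theorems.WildQuotientResolution.JordanThreeTwo

/-- **The cone chart `V[x_a]` is `G`-stable** under the lifted action of `⟨σ⟩` on
`V = Bl_I 𝔸ⁿ`, `I = (x_a, x_b², x_bx_d, x_d²)` (`σ x_a = x_a`; `hJ` abstract). [folklore] -/
theorem preimage_chart_a_eq (k : Type) [Field k] (n : ℕ)
    (σ : MvPolynomial (Fin n) k ≃ₐ[k] MvPolynomial (Fin n) k) (a b c d e : Fin n)
    (hab : a ≠ b) (hac : a ≠ c) (hae : a ≠ e)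
    (hσ : ∀ i, i ≠ b → i ≠ c → i ≠ e → σ (X i) = X i)
    (ρ : ↥(Subgroup.zpowers σ) →* Aut (Spec (CommRingCat.of (MvPolynomial (Fin n) k))))
    (hρ : ∀ g : ↥(Subgroup.zpowers σ), (ρ g).hom = Spec.map (CommRingCat.ofHom
      ((MulSemiringAction.toRingEquiv (↥(Subgroup.zpowers σ)) (MvPolynomial (Fin n) k) g⁻¹ :
        MvPolynomial (Fin n) k ≃+* MvPolynomial (Fin n) k) :
          MvPolynomial (Fin n) k →+* MvPolynomial (Fin n) k)))
    (hJ : ∀ g : ↥(Subgroup.zpowers σ),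
      (affineBlowup.idealSheaf (Ideal.span (Set.range (![X a, X b ^ 2, X b * X d, X d ^ 2] :
        Fin 4 → MvPolynomial (Fin n) k)))).comap (ρ g).hom =
        affineBlowup.idealSheaf (Ideal.span (Set.range (![X a, X b ^ 2, X b * X d, X d ^ 2] :
          Fin 4 → MvPolynomial (Fin n) k))))
    (g : ↥(Subgroup.zpowers σ)) :
    (((affineBlowup.isBlowup (Ideal.span (Set.range (![X a, X b ^ 2, X b * X d, X d ^ 2] :
        Fin 4 → MvPolynomial (Fin n) k)))).liftAction ρ hJ) g).hom ⁻¹ᵁ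
      blowupChart (affineBlowup.π (Ideal.span (Set.range (![X a, X b ^ 2, X b * X d, X d ^ 2] :
          Fin 4 → MvPolynomial (Fin n) k))))
        (affineBlowup.idealSheaf (Ideal.span (Set.range (![X a, X b ^ 2, X b * X d, X d ^ 2] :
          Fin 4 → MvPolynomial (Fin n) k))))
        ⟨⊤, isAffineOpen_top _⟩
        ((Scheme.ΓSpecIso (CommRingCat.of (MvPolynomial (Fin n) k))).inv.hom (X a)) =
      blowupChart (affineBlowup.π (Ideal.span (Set.range (![X a, X b ^ 2, X b * X d, X d ^ 2] :
          Fin 4 → MvPolynomial (Fin n) k))))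
        (affineBlowup.idealSheaf (Ideal.span (Set.range (![X a, X b ^ 2, X b * X d, X d ^ 2] :
          Fin 4 → MvPolynomial (Fin n) k))))
        ⟨⊤, isAffineOpen_top _⟩
        ((Scheme.ΓSpecIso (CommRingCat.of (MvPolynomial (Fin n) k))).inv.hom (X a)) :=
  ToricExit.preimage_blowupChart_eq_self_of_action (affineBlowup.isBlowup _) ρ
    ((affineBlowup.isBlowup _).liftAction ρ hJ)
    (fun g => (affineBlowup.isBlowup _).liftAction_hom_comp ρ hJ g) hJ
    (ι_gens_mem_ideal_top k n a b d 0)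
    (fun g => ToricExit.specAction_appTop_ΓSpecIso_inv ρ hρ (X a)
      (smul_X_a_eq k n σ a b c e hab hac hae hσ) g) g

/-- **The K–L chart `V[x_d²]` is `G`-stable** under the lifted action of `⟨σ⟩` on
`V = Bl_I 𝔸ⁿ`, `I = (x_a, x_b², x_bx_d, x_d²)` (`σ x_d = x_d`; `hJ` abstract). [folklore] -/
theorem preimage_chart_dsq_eq (k : Type) [Field k] (n : ℕ)
    (σ : MvPolynomial (Fin n) k ≃ₐ[k] MvPolynomial (Fin n) k) (a b c d e : Fin n)
    (hbd : b ≠ d) (hcd : c ≠ d) (hde : d ≠ e)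
    (hσ : ∀ i, i ≠ b → i ≠ c → i ≠ e → σ (X i) = X i)
    (ρ : ↥(Subgroup.zpowers σ) →* Aut (Spec (CommRingCat.of (MvPolynomial (Fin n) k))))
    (hρ : ∀ g : ↥(Subgroup.zpowers σ), (ρ g).hom = Spec.map (CommRingCat.ofHom
      ((MulSemiringAction.toRingEquiv (↥(Subgroup.zpowers σ)) (MvPolynomial (Fin n) k) g⁻¹ :
        MvPolynomial (Fin n) k ≃+* MvPolynomial (Fin n) k) :
          MvPolynomial (Fin n) k →+* MvPolynomial (Fin n) k)))
    (hJ : ∀ g : ↥(Subgroup.zpowers σ),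
      (affineBlowup.idealSheaf (Ideal.span (Set.range (![X a, X b ^ 2, X b * X d, X d ^ 2] :
        Fin 4 → MvPolynomial (Fin n) k)))).comap (ρ g).hom =
        affineBlowup.idealSheaf (Ideal.span (Set.range (![X a, X b ^ 2, X b * X d, X d ^ 2] :
          Fin 4 → MvPolynomial (Fin n) k))))
    (g : ↥(Subgroup.zpowers σ)) :
    (((affineBlowup.isBlowup (Ideal.span (Set.range (![X a, X b ^ 2, X b * X d, X d ^ 2] :
        Fin 4 → MvPolynomial (Fin n) k)))).liftAction ρ hJ) g).hom ⁻¹ᵁ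
      blowupChart (affineBlowup.π (Ideal.span (Set.range (![X a, X b ^ 2, X b * X d, X d ^ 2] :
          Fin 4 → MvPolynomial (Fin n) k))))
        (affineBlowup.idealSheaf (Ideal.span (Set.range (![X a, X b ^ 2, X b * X d, X d ^ 2] :
          Fin 4 → MvPolynomial (Fin n) k))))
        ⟨⊤, isAffineOpen_top _⟩
        ((Scheme.ΓSpecIso (CommRingCat.of (MvPolynomial (Fin n) k))).inv.hom (X d ^ 2)) =
      blowupChart (affineBlowup.π (Ideal.span (Set.range (![X a, X b ^ 2, X b * X d, X d ^ 2] :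
          Fin 4 → MvPolynomial (Fin n) k))))
        (affineBlowup.idealSheaf (Ideal.span (Set.range (![X a, X b ^ 2, X b * X d, X d ^ 2] :
          Fin 4 → MvPolynomial (Fin n) k))))
        ⟨⊤, isAffineOpen_top _⟩
        ((Scheme.ΓSpecIso (CommRingCat.of (MvPolynomial (Fin n) k))).inv.hom (X d ^ 2)) :=
  ToricExit.preimage_blowupChart_eq_self_of_action (affineBlowup.isBlowup _) ρ
    ((affineBlowup.isBlowup _).liftAction ρ hJ)
    (fun g => (affineBlowup.isBlowup _).liftAction_hom_comp ρ hJ g) hJ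
    (ι_gens_mem_ideal_top k n a b d 3)
    (fun g => ToricExit.specAction_appTop_ΓSpecIso_inv ρ hρ (X d ^ 2)
      (smul_X_d_sq_eq k n σ b c d e hbd hcd hde hσ) g) g

end Summit.ResolutionOfSingularities.ResolutionOfSingularities.Theorems.WildQuotientResolution.JordanThreeTwo

end
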